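import Mathlib.Analysis.SpecialFunctions.SmoothTransition
import Literature.Geometry.MetricEmbeddings.HeisenbergL1
import HarnessLib

/-!
# Vocabulary for the discretization step of Naor–Young / Lafforgue–Naor on the Heisenberg group:
displacement counts on `ℍ(ℤ)`, the real group `ℍ(ℝ)` on `ℝ³`, and the lattice bump partition of unity

Family `pnp`, layer `Literature/Geometry/MetricEmbeddings`. Definitions (no named facts) used by
the proof files that discretize a Sobolev-type inequality on the continuous Heisenberg group into
its counterpart on the discrete group — [NY18] A. Naor, R. Young, *Vertical perimeter versus
horizontal perimeter*, Ann. of Math. 188 (2018) = arXiv:1701.00620, §3.1 Lemma 3.4 (arXiv p. 20: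
"`Σ_{x ∈ Γ} (1/|B_Σ(n)|) Σ_{y ∈ B_Σ(n)} d(f(xy), f(x))^p ≤ n^p Σ_{x∈Γ} max_σ d(f(xσ), f(x))^p`",
after [LN14, Lemma 3.4]) and §3.2 Lemma 3.6 (arXiv pp. 22–23: "Since `ℍ_ℤ^{2k+1}` is a co-compact
lattice of `ℍ^{2k+1}`, we can fix from now on a compactly supported smooth function
`χ : ℍ^{2k+1} → [0,1]` such that `Σ_{g ∈ ℍ_ℤ^{2k+1}} χ(g⁻¹h) = 1` for all `h ∈ ℍ^{2k+1}`. Define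
`Φ(h) ≝ Σ_{g ∈ ℍ_ℤ^{2k+1}} χ(g⁻¹h) f(g)`"), itself after [LN14] V. Lafforgue, A. Naor, *Vertical
versus horizontal Poincaré inequalities on the Heisenberg group*, Israel J. Math. 203 (2014) =
arXiv:1212.2107, §3.3 — the route from the continuous `L₄` inequality of [NY22, Thm. 1.1] to the
hypothesis of `CheegerKleinerNaor2011_wordBall_l1Distortion.of_verticalVsHorizontal`
(`HeisenbergL1NaorYoung.lean`).

* `heisInv` — the inverse in `ℍ(ℤ) = (ℤ³, heisMul)`; `dispCount Ω w` — the DISPLACEMENT COUNT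
  `#{y ∈ Ω : y·w ∉ Ω} + #{x ∈ Ω : x·w⁻¹ ∉ Ω} = Σ_y |𝟙_Ω(yw) − 𝟙_Ω(y)|` of a finite `Ω` by `w`
  (for `w = cᵗ` the vertical perimeter `|∂ᵗ_v Ω|`, and `dispCount Ω a + dispCount Ω b = |∂_h Ω|`,
  [NY18, Def. 1.1]);
* `mulR`, `invR`, `castR` — the real Heisenberg group `ℍ(ℝ)` in the matrix (polarised) model on the
  normed space `ℝ × ℝ × ℝ` (`(x,y,z)·(x',y',z') = (x+x',y+y',z+z'+xy')`, the law of
  `Literature.NumberTheory.Sieve.Heis` and of `HeisK`), and the lattice embedding `ℤ³ ↪ ℝ³`;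
* `bump1`, `bump3`, `bumpAt g`, `smear Ω` — an EXPLICIT smooth compactly supported bump
  `ρ(s) = θ(s) − θ(s−1)` (`θ = Real.smoothTransition`) with `Σ_{n∈ℤ} ρ(s−n) = 1`, its product
  `χ(u) = ρ(u₁)ρ(u₂)ρ(u₃)`, the lattice translates `χ_g(u) = χ(g⁻¹u)` (which satisfy
  `Σ_{g ∈ ℍ(ℤ)} χ_g ≡ 1`, since left translation by `(a,b,c) ∈ ℤ³` is
  `u ↦ (u₁+a, u₂+b, u₃+c+au₂)` and the `c`-sum telescopes first), and the smearing
  `F = Σ_{g ∈ Ω} χ_g` of `𝟙_Ω` (`Φ` above with `f = 𝟙_Ω`).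

All properties (smoothness, supports, the partition-of-unity identity, the discrete Poincaré-type
lemma `dispCount Ω z ≤ n (dispCount Ω a + dispCount Ω b)` for `z ∈ 𝓑_n`) are proved in the sibling
proof files; here only the definitions and `castR_heisMul`.

## References

* [NaorYoung2018] A. Naor, R. Young, Ann. of Math. 188 (2018) 171–279, §1 Def. 1.1, §3.1
  Lemma 3.4, §3.2 Lemma 3.6 (arXiv:1701.00620 pp. 3, 20, 22–23; arXiv numbering).
-/

noncomputable section

namespace Literature.Geometry.MetricEmbeddings

/-- The inverse `g⁻¹ = (-x, -y, -z + xy)` in `ℍ(ℤ)` (`heisMul g (heisInv g) = 1`).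
[cite: NaorYoung2018, §1] -/
def heisInv (g : ℤ × ℤ × ℤ) : ℤ × ℤ × ℤ := (-g.1, -g.2.1, -g.2.2 + g.1 * g.2.1)

/-- **The displacement count** of a finite `Ω ⊂ ℍ_ℤ³` by `w`: the number of `y` with exactly one
of `y`, `y·w` in `Ω`, written as `#{y ∈ Ω : y·w ∉ Ω} + #{x ∈ Ω : x·w⁻¹ ∉ Ω}`; equivalently
`Σ_y |𝟙_Ω(y w) − 𝟙_Ω(y)|`. For `w = cᵗ` this is `|∂ᵗ_v Ω|`, and
`dispCount Ω a + dispCount Ω b = |∂_h Ω|` [NY18, Def. 1.1]. [cite: NaorYoung2018, §3.1 Lemma 3.4] -/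
def dispCount (Ω : Finset (ℤ × ℤ × ℤ)) (w : ℤ × ℤ × ℤ) : ℕ :=
  (Ω.filter fun y => heisMul y w ∉ Ω).card + (Ω.filter fun x => heisMul x (heisInv w) ∉ Ω).card

/-- The real Heisenberg group `ℍ(ℝ)` in the matrix (polarised) model on `ℝ × ℝ × ℝ`:
`(x,y,z)·(x',y',z') = (x+x', y+y', z+z'+xy')`, containing `ℍ(ℤ) = (ℤ³, heisMul)` as the integer
points (`castR_heisMul`). This is the law of `Literature.NumberTheory.Sieve.Heis` / `HeisK`, written
on the normed space `ℝ × ℝ × ℝ` so that calculus (`fderiv`) applies. [cite: NaorYoung2018, §2] -/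
def mulR (g u : ℝ × ℝ × ℝ) : ℝ × ℝ × ℝ := (g.1 + u.1, g.2.1 + u.2.1, g.2.2 + u.2.2 + g.1 * u.2.1)

/-- The inverse `(x,y,z)⁻¹ = (−x, −y, −z + xy)` in `ℍ(ℝ)`. [cite: NaorYoung2018, §2] -/
def invR (g : ℝ × ℝ × ℝ) : ℝ × ℝ × ℝ := (-g.1, -g.2.1, -g.2.2 + g.1 * g.2.1)

/-- The lattice embedding `ℍ(ℤ) ↪ ℍ(ℝ)`, `(a,b,c) ↦ (a,b,c)`. [cite: NaorYoung2018, §2] -/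
def castR (g : ℤ × ℤ × ℤ) : ℝ × ℝ × ℝ := ((g.1 : ℝ), (g.2.1 : ℝ), (g.2.2 : ℝ))

/-- **The one-dimensional bump** `ρ(s) = θ(s) − θ(s − 1)` built from Mathlib's smooth transition
`θ = Real.smoothTransition` (`θ = 0` on `(−∞,0]`, `θ = 1` on `[1,∞)`): smooth, `0 ≤ ρ ≤ 1`,
supported in `[0, 2]`, and an EXACT partition of unity under integer translation,
`Σ_{n ∈ ℤ} ρ(s − n) = 1` (the sum telescopes; `sum_bump1_window`). [folklore] -/
def bump1 (s : ℝ) : ℝ := Real.smoothTransition s - Real.smoothTransition (s - 1)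

/-- The three-dimensional bump `χ(u) = ρ(u₁) ρ(u₂) ρ(u₃)` on `ℍ(ℝ) = ℝ³` (smooth, values in `[0,1]`,
supported in the box `[0,2]³`). [cite: NaorYoung2018, §3.2 Lemma 3.6] -/
def bump3 (u : ℝ × ℝ × ℝ) : ℝ := bump1 u.1 * bump1 u.2.1 * bump1 u.2.2

/-- The left translate `χ_g(u) = χ(g⁻¹ u)` of the bump by a lattice point `g ∈ ℍ(ℤ)` ("a compactly
supported smooth `χ` with `Σ_{g ∈ ℍ_ℤ} χ(g⁻¹h) = 1` for all `h`", here an explicit one: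
`sum_bumpAt_window`). [cite: NaorYoung2018, §3.2 Lemma 3.6] -/
def bumpAt (g : ℤ × ℤ × ℤ) (u : ℝ × ℝ × ℝ) : ℝ := bump3 (mulR (invR (castR g)) u)

/-- **The smearing** `F = Σ_{g ∈ Ω} χ_g` of the indicator of a finite `Ω ⊂ ℍ(ℤ)`
(`Φ(h) = Σ_g χ(g⁻¹h) f(g)` of [NY18, proof of Lemma 3.6], for `f = 𝟙_Ω`): a smooth compactly
supported function on `ℍ(ℝ)`. [cite: NaorYoung2018, §3.2 Lemma 3.6] -/
def smear (Ω : Finset (ℤ × ℤ × ℤ)) (u : ℝ × ℝ × ℝ) : ℝ := ∑ g ∈ Ω, bumpAt g u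

/-- The lattice embedding is multiplicative: `castR (g·h) = castR g · castR h`.
[cite: NaorYoung2018, §2] -/
theorem castR_heisMul (g h : ℤ × ℤ × ℤ) : castR (heisMul g h) = mulR (castR g) (castR h) := by
  simp only [castR, heisMul, mulR, Prod.mk.injEq]
  push_cast
  exact ⟨rfl, rfl, by ring⟩

end Literature.Geometry.MetricEmbeddings

end
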